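import Literature.NumberTheory.Automorphic.GL2SplitTorusOrbitalVanishing
import Literature.NumberTheory.Automorphic.WhittakerCoeffLocalDatum
import Literature.NumberTheory.Automorphic.GLnCuspidalSpectrumProofs
import Literature.RingTheory.DiscreteValuationRing.AdicCompletionResidueField
import Mathlib.NumberTheory.NumberField.Ideal.Basic
import HarnessLib

/-!
# An explicit supercusp form on `GL₂(K_v)` at every finite place
(Jacquet–Langlands, LNM 114 (1970), §16, p. 503; Gelbart, *Automorphic forms on adele groups* (1975),
Remark 9.23, p. 140 and (10.16); Harish-Chandra, LNM 162 (1970), Part I §3; Bushnell–Henniart,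
*The local Langlands conjecture for `GL(2)`* (2006), §11 (cuspidal inducing data of positive level))

Topic `NumberTheory/Automorphic`; definitions with bodies (`GL2LocalSupercuspForm.red`, `.lin`,
`.form`) and theorems; no named fact, no instance visible to importers.

For the simple trace formula / the cuspidal-image principle of Jacquet–Langlands §16 ("if `f_v` is a
super cusp form … `ρ(f)` maps `L²` into the space of cusp forms"; in the tree:
`SupercuspTypeCuspidalImage`, `SupercuspidalPlaceNonvanishingCusp`) one needs, at a finite place `v`
of the number field `K`, a **supercusp form**: `ξ ∈ C_c(GL₂(K_v))` with
`∫_{K_v} ξ(a n(x) b) dx = 0` for all `a, b ∈ GL₂(K_v)` (`n(x) = (1 x; 0 1)`). The tree obtains such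
`ξ` from matrix coefficients of a supercuspidal *representation* (`SupercuspidalTestFunctions`), whose
existence it does not prove. This file constructs one **from scratch, at every finite place `v`**,
by inflating a cusp form of the finite group `GL₂(𝒪_v / 𝔭_v²)` of positive level (the standard
"generic character of `1 + 𝔭 M₂(𝒪)`" device behind the positive-level supercuspidals of
Bushnell–Henniart §11, §15): with `k_v = 𝒪_v/𝔭_v` (`q_v` elements), `ϖ` a uniformizer and
`c ∈ k_v` **not of the form `x² - x`** (such `c` exist: `x ↦ x² - x` is not injective on the finite
field `k_v`), put `Y = (0 c; 1 -1) ∈ M₂(k_v)` — a matrix with **no eigenvector** — and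
`ℓ(M) = c̃ M₁₀ + M₀₁ - M₁₁ = tr(Ỹ M)` for a lift `c̃ ∈ 𝒪_v`. Then

  `ξ(g) = q_v - 1` if `g ∈ U_1 = 1 + 𝔭 M₂(𝒪_v)` and `ℓ(g - 1) ∈ 𝔭²`, `ξ(g) = -1` if `g ∈ U_1` and
  `ℓ(g - 1) ∉ 𝔭²`, `ξ(g) = 0` off `U_1`

(`q · 1_{ker ψ_Y} - 1` on the abelian group `U_1/U_2 ≅ M₂(k_v)`, a sum of the non-trivial characters
of `U_1/U_2` trivial on the hyperplane `tr(Y X) = 0`; it is a matrix coefficient of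
`Ind_{U_1}^{GL₂(𝒪)} ψ_Y`, which has no `N(𝒪)`-fixed vector because no conjugate of `Y` is upper
triangular). Results (`U_m = localCongruenceSubgroup 2 K v m`):

* `form_mul_of_mem`, `form_mul_of_mem_left` — `ξ` is bi-`U_2`-invariant; `continuous_form`,
  `hasCompactSupport_form`, `tsupport_form_subset`; `form_one`, `form_one_ne_zero` (`ξ(1) = q_v - 1`).
* `sum_form_unipotent_eq_zero` — **the finite cusp-form identity**: for `k₁, k₂ ∈ GL₂(𝒪_v)`,
  `Σ_{r} ξ(k₁ n(r) k₂) = 0`, `r` over the `q_v²` representatives `σ(a) + ϖ σ(b)` of `𝒪_v/𝔭_v²`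
  (the `r` with `k₁ n(r) k₂ ∈ U_1` form one class mod `𝔭`; on it `ℓ ≡ ϖ (s + t λ) (mod 𝔭²)` with
  `λ̄ = (k̄₂ Y k̄₂⁻¹)₁₀ ≠ 0`, so exactly one of the `q_v` values of `t̄` gives `ℓ ∈ 𝔭²`).
* `integral_form_unipotentGL2_eq_zero` — **`ξ` is a supercusp form**: `∫ ξ(a n(x) b) dx = 0` for all
  `a, b` and every additive Haar measure `dx` on `K_v` (Iwasawa `a = k d n(t)`, translation and
  dilation invariance reduce to `a ∈ GL₂(𝒪_v)`; then averaging over the `r` makes the integrand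
  vanish identically); `integral_form_unipotentOfBlock_eq_zero` — the same in the `𝔫₁`-form consumed
  by `SupercuspidalPlaceNonvanishingCusp.integral_localTestFunction_comp_glUnipotent_eq_zero`.

## References

* H. Jacquet, R. P. Langlands, *Automorphic forms on `GL(2)`*, LNM 114 (1970), §16, p. 503
  [JacquetLanglands1970].
* S. Gelbart, *Automorphic forms on adele groups*, Ann. of Math. Studies 83 (1975), Remark 9.23,
  p. 140; §10, (10.16) [Gelbart1975].
* C. J. Bushnell, G. Henniart, *The local Langlands conjecture for `GL(2)`*, Grundlehren 335
  (2006), §11, §15 [BushnellHenniart2006].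
-/

noncomputable section

open scoped MatrixGroups Classical
open NumberField IsDedekindDomain MeasureTheory Matrix

namespace Literature.NumberTheory.Automorphic

namespace GL2LocalSupercuspForm

variable (K : Type) [Field K] [NumberField K] (v : HeightOneSpectrum (𝓞 K))

local notation "Kv" => HeightOneSpectrum.adicCompletion K v
set_option quotPrecheck false in
local notation "Ov" => ↥(HeightOneSpectrum.adicCompletionIntegers K v)
set_option quotPrecheck false in
local notation "kv" => IsLocalRing.ResidueField ↥(HeightOneSpectrum.adicCompletionIntegers K v)
set_option quotPrecheck false in
/-- `n(x) = (1 x; 0 1) ∈ GL₂`. -/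
local notation "𝐧" x => (((unipotentGL2 x : ↥(upperUnitriangular (Fin 2) (HeightOneSpectrum.adicCompletion K v))) :
  GL (Fin 2) (HeightOneSpectrum.adicCompletion K v)))

/-! ### Valuation inequalities in `ℤᵐ⁰` -/

variable {K v}

/-- `|x| < 1 ↔ |x| ≤ |ϖ| = exp (-1)` in the discrete value group. [folklore] -/
theorem valued_lt_one_iff (x : Kv) : Valued.v x < 1 ↔ Valued.v x ≤ WithZero.exp (-1 : ℤ) := by
  rw [← WithZero.lt_mul_exp_iff_le WithZero.exp_ne_zero, ← WithZero.exp_add, neg_add_cancel,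
    WithZero.exp_zero]

/-- `|x| ≤ exp (-(m+1)) ↔ |x| < exp (-m)`. [folklore] -/
theorem valued_le_exp_neg_succ_iff (x : Kv) (m : ℤ) :
    Valued.v x ≤ WithZero.exp (-(m + 1)) ↔ Valued.v x < WithZero.exp (-m) := by
  rw [← WithZero.lt_mul_exp_iff_le WithZero.exp_ne_zero, ← WithZero.exp_add]
  congr! 2
  ring

/-- Ultrametric absorption: if `|y| ≤ c` then `|x + y| ≤ c ↔ |x| ≤ c`. [folklore] -/
theorem valued_add_le_iff_of_le {x y : Kv} {c : WithZero (Multiplicative ℤ)} (hy : Valued.v y ≤ c) :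
    Valued.v (x + y) ≤ c ↔ Valued.v x ≤ c := by
  constructor
  · intro h
    have : x = x + y + -y := by ring
    rw [this]
    exact Valued.v.map_add_le h (by rwa [Valuation.map_neg])
  · intro h
    exact Valued.v.map_add_le h hy

/-! ### The reduction map `K_v ⊇ 𝒪_v → k_v` extended by `0` -/

/-- The residue map `𝒪_v → k_v` extended by `0` to `K_v` (junk off `𝒪_v`). [folklore] -/
def red (x : Kv) : kv :=
  if h : Valued.v x ≤ 1 then
    IsLocalRing.residue Ov ⟨x, (HeightOneSpectrum.mem_adicCompletionIntegers (𝓞 K) K v).2 h⟩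
  else 0

/-- `red` on an integer is its residue class. [folklore] -/
theorem red_of_le {x : Kv} (h : Valued.v x ≤ 1) :
    red x = IsLocalRing.residue Ov
      ⟨x, (HeightOneSpectrum.mem_adicCompletionIntegers (𝓞 K) K v).2 h⟩ := by
  rw [red, dif_pos h]

/-- `red ↑y = residue y` for `y ∈ 𝒪_v`. [folklore] -/
theorem red_coe (y : Ov) : red (y : Kv) = IsLocalRing.residue Ov y := by
  rw [red_of_le ((HeightOneSpectrum.mem_adicCompletionIntegers (𝓞 K) K v).1 y.2)]

/-- An integer has residue `0` iff its valuation is `< 1`. [folklore] -/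
theorem red_eq_zero_iff {x : Kv} (h : Valued.v x ≤ 1) : red x = 0 ↔ Valued.v x < 1 := by
  rw [red_of_le h, IsLocalRing.residue_eq_zero_iff, ValuationSubring.valuation_lt_one_iff]
  exact ((Valuation.isEquiv_valuation_valuationSubring
    (Valued.v : Valuation (HeightOneSpectrum.adicCompletion K v) _)).lt_one_iff_lt_one).symm

/-- `red (x + y) = red x + red y` for integers. [folklore] -/
theorem red_add {x y : Kv} (hx : Valued.v x ≤ 1) (hy : Valued.v y ≤ 1) :
    red (x + y) = red x + red y := by
  rw [red_of_le hx, red_of_le hy, red_of_le (Valued.v.map_add_le hx hy), ← map_add]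
  rfl

/-- `red (x * y) = red x * red y` for integers. [folklore] -/
theorem red_mul {x y : Kv} (hx : Valued.v x ≤ 1) (hy : Valued.v y ≤ 1) :
    red (x * y) = red x * red y := by
  have hxy : Valued.v (x * y) ≤ 1 := by
    rw [map_mul]
    exact mul_le_one' hx hy
  rw [red_of_le hx, red_of_le hy, red_of_le hxy, ← map_mul]
  rfl

/-- `red (-x) = - red x` for integers. [folklore] -/
theorem red_neg {x : Kv} (hx : Valued.v x ≤ 1) : red (-x) = -red x := by
  have hnx : Valued.v (-x) ≤ 1 := by rwa [Valuation.map_neg]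
  rw [red_of_le hx, red_of_le hnx, ← map_neg]
  rfl

/-- `red (x - y) = red x - red y` for integers. [folklore] -/
theorem red_sub {x y : Kv} (hx : Valued.v x ≤ 1) (hy : Valued.v y ≤ 1) :
    red (x - y) = red x - red y := by
  rw [sub_eq_add_neg, red_add hx (by rwa [Valuation.map_neg]), red_neg hy, sub_eq_add_neg]

/-- `red 1 = 1`. [folklore] -/
theorem red_one : red (1 : Kv) = 1 := by
  rw [red_of_le (le_of_eq Valued.v.map_one), ← (IsLocalRing.residue Ov).map_one]
  rfl

/-- `red 0 = 0`. [folklore] -/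
theorem red_zero : red (0 : Kv) = 0 := by
  rw [red_of_le (by rw [Valuation.map_zero]; exact zero_le), ← (IsLocalRing.residue Ov).map_zero]
  rfl

/-- `red` is surjective on the integers: every residue class has a representative. [folklore] -/
theorem exists_red_eq (a : kv) : ∃ x : Kv, Valued.v x ≤ 1 ∧ red x = a := by
  obtain ⟨y, rfl⟩ := IsLocalRing.residue_surjective a
  exact ⟨y, (HeightOneSpectrum.mem_adicCompletionIntegers (𝓞 K) K v).1 y.2, red_coe y⟩

/-! ### The level groups `U_m = 1 + 𝔭^m M₂(𝒪_v)` (`localCongruenceSubgroup 2 K v m`) -/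

/-- Membership in `U_m`: `g`, `g⁻¹` integral and `g ≡ 1 (mod 𝔭^m)`. [folklore] -/
theorem mem_level_iff {m : ℕ} {g : GL (Fin 2) Kv} :
    g ∈ localCongruenceSubgroup 2 K v m ↔
      (∀ i j, Valued.v ((g : Matrix (Fin 2) (Fin 2) Kv) i j) ≤ 1) ∧
        (∀ i j, Valued.v (((g⁻¹ : GL (Fin 2) Kv) : Matrix (Fin 2) (Fin 2) Kv) i j) ≤ 1) ∧
        ∀ i j, Valued.v (((g : Matrix (Fin 2) (Fin 2) Kv) - 1) i j) ≤ WithZero.exp (-(m : ℤ)) :=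
  mem_valuedCongruenceSubgroup_iff

/-- `U_{m} ≤ U_{m'}` for `m' ≤ m`. [folklore] -/
theorem level_le {m m' : ℕ} (h : m' ≤ m) :
    localCongruenceSubgroup 2 K v m ≤ localCongruenceSubgroup 2 K v m' :=
  localCongruenceSubgroup_antitone 2 K v h

variable (K v) in
/-- `U_0 = GL₂(𝒪_v)` is the hyperspecial subgroup `glInt` of the `ValuativeRel` language
(`glInt_adicCompletion_eq`). [folklore] -/
theorem glInt_eq_level_zero : glInt 2 Kv = localCongruenceSubgroup 2 K v 0 := by
  rw [glInt_adicCompletion_eq, localCongruenceSubgroup, Nat.cast_zero, neg_zero, WithZero.exp_zero]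

/-- `exp (-m) ≤ 1`. [folklore] -/
theorem exp_neg_natCast_le_one (m : ℕ) : WithZero.exp (-(m : ℤ)) ≤ (1 : WithZero (Multiplicative ℤ)) := by
  rw [← WithZero.exp_zero, WithZero.exp_le_exp]
  omega

/-- **`U_m` is normal in `GL₂(𝒪_v)`**: `k g k⁻¹ ∈ U_m` for `k ∈ U_0`, `g ∈ U_m`
(`k (g - 1) k⁻¹` has entries of valuation `≤ |ϖ|^m`). [folklore] -/
theorem conj_mem_level {m : ℕ} {k g : GL (Fin 2) Kv} (hk : k ∈ localCongruenceSubgroup 2 K v 0)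
    (hg : g ∈ localCongruenceSubgroup 2 K v m) : k * g * k⁻¹ ∈ localCongruenceSubgroup 2 K v m := by
  have hg0 : g ∈ localCongruenceSubgroup 2 K v 0 := level_le (Nat.zero_le m) hg
  have hkgk : k * g * k⁻¹ ∈ localCongruenceSubgroup 2 K v 0 :=
    Subgroup.mul_mem _ (Subgroup.mul_mem _ hk hg0) (Subgroup.inv_mem _ hk)
  rw [mem_level_iff] at hk hg hkgk ⊢
  refine ⟨hkgk.1, hkgk.2.1, fun i j => ?_⟩
  have hmat : ((k * g * k⁻¹ : GL (Fin 2) Kv) : Matrix (Fin 2) (Fin 2) Kv) - 1 =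
      (k : Matrix (Fin 2) (Fin 2) Kv) * ((g : Matrix (Fin 2) (Fin 2) Kv) - 1) *
        ((k⁻¹ : GL (Fin 2) Kv) : Matrix (Fin 2) (Fin 2) Kv) := by
    have hkk : (k : Matrix (Fin 2) (Fin 2) Kv) * ((k⁻¹ : GL (Fin 2) Kv) : Matrix (Fin 2) (Fin 2) Kv) = 1 := by
      rw [← Units.val_mul, mul_inv_cancel, Units.val_one]
    rw [Units.val_mul, Units.val_mul, Matrix.mul_sub, Matrix.sub_mul, Matrix.mul_one, hkk]
  rw [hmat]
  have h1 := valued_mul_apply_le (m := Fin 2) hk.1 hg.2.2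
  have h2 := valued_mul_apply_le (m := Fin 2) h1 hk.2.1 i j
  simpa only [one_mul, mul_one] using h2

/-- `k⁻¹ g k ∈ U_m` for `k ∈ U_0`, `g ∈ U_m`. [folklore] -/
theorem inv_conj_mem_level {m : ℕ} {k g : GL (Fin 2) Kv} (hk : k ∈ localCongruenceSubgroup 2 K v 0)
    (hg : g ∈ localCongruenceSubgroup 2 K v m) : k⁻¹ * g * k ∈ localCongruenceSubgroup 2 K v m := by
  simpa only [inv_inv] using conj_mem_level (Subgroup.inv_mem _ hk) hg

/-- **`n(x) ∈ U_m ↔ |x| ≤ |ϖ|^m`.** [folklore] -/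
theorem unipotent_mem_level_iff (x : Kv) (m : ℕ) :
    (𝐧 x) ∈ localCongruenceSubgroup 2 K v m ↔ Valued.v x ≤ WithZero.exp (-(m : ℤ)) := by
  rw [mem_level_iff, GL2.coe_unipotentGL2_inv, coe_unipotentGL2, coe_unipotentGL2]
  constructor
  · rintro ⟨-, -, h⟩
    simpa using h 0 1
  · intro h
    have h1 : Valued.v x ≤ 1 := h.trans (exp_neg_natCast_le_one m)
    have hsub : (!![1, x; 0, 1] : Matrix (Fin 2) (Fin 2) Kv) - 1 = !![0, x; 0, 0] := by
      ext i j; fin_cases i <;> fin_cases j <;> simp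
    have h' : Valued.v x ≤ (WithZero.exp (m : ℤ))⁻¹ := by rwa [← WithZero.exp_neg]
    refine ⟨fun i j => ?_, fun i j => ?_, fun i j => ?_⟩
    · fin_cases i <;> fin_cases j <;> simp [h1]
    · fin_cases i <;> fin_cases j <;> simp [Valuation.map_neg, h1]
    · rw [hsub]
      fin_cases i <;> fin_cases j <;> simp [h']

/-- `n(x) ∈ GL₂(𝒪_v) ↔ |x| ≤ 1`. [folklore] -/
theorem unipotent_mem_level_zero_iff (x : Kv) :
    (𝐧 x) ∈ localCongruenceSubgroup 2 K v 0 ↔ Valued.v x ≤ 1 := by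
  rw [unipotent_mem_level_iff, Nat.cast_zero, neg_zero, WithZero.exp_zero]

/-! ### The datum: a non-split residue class `c`, a lift, a uniformizer, the linear form `ℓ` -/

variable (K v) in
/-- There is `c ∈ k_v` with `x² - x ≠ c` for all `x` (the map `x ↦ x² - x` identifies `0` and `1`,
so it is not injective, hence not surjective, on the finite field `k_v`). [folklore] -/
theorem exists_forall_sq_sub_ne : ∃ c : kv, ∀ x : kv, x * x - x ≠ c := by
  by_contra h
  push Not at h
  have hsurj : Function.Surjective fun x : kv => x * x - x := fun c => h c
  have hinj : Function.Injective fun x : kv => x * x - x := Finite.injective_iff_surjective.2 hsurj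
  have h01 : (fun x : kv => x * x - x) 0 = (fun x : kv => x * x - x) 1 := by simp
  exact zero_ne_one (hinj h01)

variable (K v) in
/-- The chosen non-split residue class `c ∈ k_v` (`x² - x ≠ c` for all `x`). [folklore] -/
def cres : kv := Classical.choose (exists_forall_sq_sub_ne K v)

/-- `cres` is not of the form `x * x - x`. [folklore] -/
theorem sq_sub_ne_cres (x : kv) : x * x - x ≠ cres K v := Classical.choose_spec (exists_forall_sq_sub_ne K v) x

variable (K v) in
/-- A lift `c̃ ∈ 𝒪_v` of `c`. [folklore] -/
def clift : Kv := Classical.choose (exists_red_eq (cres K v))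

/-- The lift `clift` of `cres` is integral. [folklore] -/
theorem valued_clift_le : Valued.v (clift K v) ≤ 1 := (Classical.choose_spec (exists_red_eq (cres K v))).1

/-- The lift `clift` reduces to `cres`. [folklore] -/
theorem red_clift : red (clift K v) = cres K v := (Classical.choose_spec (exists_red_eq (cres K v))).2

variable (K v) in
/-- A uniformizer exists in `K_v`: the image of a `v`-uniformizer of `K`
(`valuation_exists_uniformizer`, `valuedAdicCompletion_eq_valuation'`). [folklore] -/
theorem exists_valued_eq_exp_neg_one : ∃ ϖ : Kv, Valued.v ϖ = WithZero.exp (-1 : ℤ) := by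
  obtain ⟨π, hπ⟩ := v.valuation_exists_uniformizer K
  exact ⟨(π : Kv), by rw [HeightOneSpectrum.valuedAdicCompletion_eq_valuation', hπ]⟩

variable (K v) in
/-- The chosen uniformizer `ϖ` of `K_v`, `|ϖ| = exp (-1)`. [folklore] -/
def unif : Kv := Classical.choose (exists_valued_eq_exp_neg_one K v)

/-- `unif` has valuation `exp (-1)`: it is a uniformizer. [folklore] -/
theorem valued_unif : Valued.v (unif K v) = WithZero.exp (-1 : ℤ) :=
  Classical.choose_spec (exists_valued_eq_exp_neg_one K v)

/-- The uniformizer `unif` is integral. [folklore] -/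
theorem valued_unif_le : Valued.v (unif K v) ≤ 1 := by
  rw [valued_unif]; exact exp_neg_natCast_le_one 1

/-- The uniformizer `unif` is non-zero. [folklore] -/
theorem unif_ne_zero : unif K v ≠ 0 := by
  intro h
  have := valued_unif (K := K) (v := v)
  rw [h, map_zero] at this
  exact WithZero.coe_ne_zero this.symm

/-- `|ϖ y| ≤ exp (-(m+1)) ↔ |y| ≤ exp (-m)`. [folklore] -/
theorem valued_unif_mul_le_iff (y : Kv) (m : ℤ) :
    Valued.v (unif K v * y) ≤ WithZero.exp (-(m + 1)) ↔ Valued.v y ≤ WithZero.exp (-m) := by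
  rw [map_mul, valued_unif, show (-(m + 1) : ℤ) = -1 + -m by ring, WithZero.exp_add]
  exact mul_le_mul_iff_right₀ (zero_lt_iff.2 WithZero.exp_ne_zero)

variable (K v) in
/-- The linear form `ℓ(M) = c̃ M₁₀ + M₀₁ - M₁₁` (`= tr(Ỹ M)`, `Ỹ = (0 c̃; 1 -1)`). [folklore] -/
def lin (M : Matrix (Fin 2) (Fin 2) Kv) : Kv := clift K v * M 1 0 + M 0 1 - M 1 1

/-- `lin` is additive. [folklore] -/
theorem lin_add (M N : Matrix (Fin 2) (Fin 2) Kv) : lin K v (M + N) = lin K v M + lin K v N := by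
  simp only [lin, Matrix.add_apply]; ring

/-- `lin` is homogeneous. [folklore] -/
theorem lin_smul (a : Kv) (M : Matrix (Fin 2) (Fin 2) Kv) : lin K v (a • M) = a * lin K v M := by
  simp only [lin, Matrix.smul_apply, smul_eq_mul]; ring

/-- `lin 0 = 0`. [folklore] -/
theorem lin_zero : lin K v 0 = 0 := by simp [lin]

/-- If all entries of `M` have valuation `≤ b` then `|ℓ(M)| ≤ b`. [folklore] -/
theorem valued_lin_le {M : Matrix (Fin 2) (Fin 2) Kv} {b : WithZero (Multiplicative ℤ)}
    (hM : ∀ i j, Valued.v (M i j) ≤ b) : Valued.v (lin K v M) ≤ b := by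
  unfold lin
  refine Valued.v.map_sub_le (Valued.v.map_add_le ?_ (hM 0 1)) (hM 1 1)
  rw [map_mul]
  exact mul_le_of_le_one_of_le valued_clift_le (hM 1 0)

/-- `red (ℓ M) = c · red M₁₀ + red M₀₁ - red M₁₁` for an integral `M`. [folklore] -/
theorem red_lin {M : Matrix (Fin 2) (Fin 2) Kv} (hM : ∀ i j, Valued.v (M i j) ≤ 1) :
    red (lin K v M) = cres K v * red (M 1 0) + red (M 0 1) - red (M 1 1) := by
  have h10 : Valued.v (clift K v * M 1 0) ≤ 1 := by
    rw [map_mul]; exact mul_le_one' valued_clift_le (hM 1 0)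
  unfold lin
  rw [red_sub (Valued.v.map_add_le h10 (hM 0 1)) (hM 1 1), red_add h10 (hM 0 1),
    red_mul valued_clift_le (hM 1 0), red_clift]

/-! ### The form `ξ` -/

variable (K v) in
/-- `q_v`, the cardinality of the residue field of `K_v`. [folklore] -/
def qv : ℕ := Nat.card kv

/-- The residue field has at least two elements: `1 < qv`. [folklore] -/
theorem one_lt_qv : 1 < qv K v := by
  haveI : Fintype kv := Fintype.ofFinite _
  rw [qv, Nat.card_eq_fintype_card]
  exact Fintype.one_lt_card

variable (K v) in
/-- The congruence condition `ℓ(g - 1) ∈ 𝔭²`. [folklore] -/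
def Cond (g : GL (Fin 2) Kv) : Prop :=
  Valued.v (lin K v ((g : Matrix (Fin 2) (Fin 2) Kv) - 1)) ≤ WithZero.exp (-2 : ℤ)

variable (K v) in
/-- **The supercusp form `ξ` on `GL₂(K_v)`**: `q_v - 1` on `{g ∈ U_1 | ℓ(g-1) ∈ 𝔭²}`, `-1` on the
rest of `U_1`, `0` off `U_1` (the inflation of the cusp form `q 1_{ker ψ_Y} - 1` of `GL₂(𝒪/𝔭²)`;
Bushnell–Henniart §11: cuspidal inducing data of positive level). [cite: BushnellHenniart2006, §11] -/
def form (g : GL (Fin 2) Kv) : ℂ :=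
  if g ∈ localCongruenceSubgroup 2 K v 1 then (if Cond K v g then ((qv K v : ℂ) - 1) else -1) else 0

/-- `form` vanishes off the first congruence subgroup `U₁`. [folklore] -/
theorem form_of_not_mem {g : GL (Fin 2) Kv} (hg : g ∉ localCongruenceSubgroup 2 K v 1) : form K v g = 0 := by
  rw [form, if_neg hg]

/-- The value of `form` on `U₁`: `qv - 1` where `Cond` holds, `-1` elsewhere. [folklore] -/
theorem form_of_mem {g : GL (Fin 2) Kv} (hg : g ∈ localCongruenceSubgroup 2 K v 1) :
    form K v g = if Cond K v g then ((qv K v : ℂ) - 1) else -1 := by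
  rw [form, if_pos hg]

/-- A point where `form` is non-zero lies in `U₁`. [folklore] -/
theorem mem_of_form_ne_zero {g : GL (Fin 2) Kv} (hg : form K v g ≠ 0) :
    g ∈ localCongruenceSubgroup 2 K v 1 := by
  by_contra h
  exact hg (form_of_not_mem h)

/-- `ξ(1) = q_v - 1`. [folklore] -/
theorem form_one : form K v 1 = (qv K v : ℂ) - 1 := by
  rw [form_of_mem (Subgroup.one_mem _), if_pos]
  change Valued.v (lin K v (((1 : GL (Fin 2) Kv) : Matrix (Fin 2) (Fin 2) Kv) - 1)) ≤ _
  rw [Units.val_one, sub_self, lin_zero, map_zero]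
  exact zero_le

/-- `form 1 ≠ 0`. [folklore] -/
theorem form_one_ne_zero : form K v 1 ≠ 0 := by
  rw [form_one, sub_ne_zero]
  have h := one_lt_qv (K := K) (v := v)
  exact_mod_cast h.ne'

/-- `Cond` is insensitive to right multiplication by `U_2` on `U_1`:
`g u - 1 = (g - 1) + g (u - 1)` and `ℓ(g (u - 1)) ∈ 𝔭²`. [folklore] -/
theorem cond_mul_iff {g u : GL (Fin 2) Kv} (hg : g ∈ localCongruenceSubgroup 2 K v 1)
    (hu : u ∈ localCongruenceSubgroup 2 K v 2) : Cond K v (g * u) ↔ Cond K v g := by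
  rw [mem_level_iff] at hg hu
  have hmat : ((g * u : GL (Fin 2) Kv) : Matrix (Fin 2) (Fin 2) Kv) - 1 =
      ((g : Matrix (Fin 2) (Fin 2) Kv) - 1) + (g : Matrix (Fin 2) (Fin 2) Kv) * ((u : Matrix _ _ Kv) - 1) := by
    rw [Units.val_mul, Matrix.mul_sub, Matrix.mul_one]; abel
  unfold Cond
  rw [hmat, lin_add]
  refine valued_add_le_iff_of_le (valued_lin_le fun i j => ?_)
  simpa only [one_mul, Nat.cast_ofNat] using valued_mul_apply_le (m := Fin 2) hg.1 hu.2.2 i j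

/-- … and to left multiplication: `u g - 1 = (g - 1) + (u - 1) g`. [folklore] -/
theorem cond_mul_iff_left {g u : GL (Fin 2) Kv} (hg : g ∈ localCongruenceSubgroup 2 K v 1)
    (hu : u ∈ localCongruenceSubgroup 2 K v 2) : Cond K v (u * g) ↔ Cond K v g := by
  rw [mem_level_iff] at hg hu
  have hmat : ((u * g : GL (Fin 2) Kv) : Matrix (Fin 2) (Fin 2) Kv) - 1 =
      ((g : Matrix (Fin 2) (Fin 2) Kv) - 1) + ((u : Matrix _ _ Kv) - 1) * (g : Matrix (Fin 2) (Fin 2) Kv) := by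
    rw [Units.val_mul, Matrix.sub_mul, Matrix.one_mul]; abel
  unfold Cond
  rw [hmat, lin_add]
  refine valued_add_le_iff_of_le (valued_lin_le fun i j => ?_)
  simpa only [mul_one, Nat.cast_ofNat] using valued_mul_apply_le (m := Fin 2) hu.2.2 hg.1 i j

/-- **`ξ` is right `U_2`-invariant.** [folklore] -/
theorem form_mul_of_mem (g : GL (Fin 2) Kv) {u : GL (Fin 2) Kv} (hu : u ∈ localCongruenceSubgroup 2 K v 2) :
    form K v (g * u) = form K v g := by
  have hu1 : u ∈ localCongruenceSubgroup 2 K v 1 := level_le one_le_two hu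
  by_cases hg : g ∈ localCongruenceSubgroup 2 K v 1
  · rw [form_of_mem hg, form_of_mem (Subgroup.mul_mem _ hg hu1), cond_mul_iff hg hu]
  · have hgu : g * u ∉ localCongruenceSubgroup 2 K v 1 := fun h => hg (by
      have h' := Subgroup.mul_mem _ h (Subgroup.inv_mem _ hu1)
      rwa [mul_inv_cancel_right] at h')
    rw [form_of_not_mem hg, form_of_not_mem hgu]

/-- **`ξ` is left `U_2`-invariant.** [folklore] -/
theorem form_mul_of_mem_left {u : GL (Fin 2) Kv} (hu : u ∈ localCongruenceSubgroup 2 K v 2) (g : GL (Fin 2) Kv) :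
    form K v (u * g) = form K v g := by
  have hu1 : u ∈ localCongruenceSubgroup 2 K v 1 := level_le one_le_two hu
  by_cases hg : g ∈ localCongruenceSubgroup 2 K v 1
  · rw [form_of_mem hg, form_of_mem (Subgroup.mul_mem _ hu1 hg), cond_mul_iff_left hg hu]
  · have hgu : u * g ∉ localCongruenceSubgroup 2 K v 1 := fun h => hg (by
      have h' := Subgroup.mul_mem _ (Subgroup.inv_mem _ hu1) h
      rwa [inv_mul_cancel_left] at h')
    rw [form_of_not_mem hg, form_of_not_mem hgu]

/-- **`ξ` is continuous** (locally constant: constant on the open cosets `g U_2`). [folklore] -/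
theorem continuous_form : Continuous (form K v) := by
  have hlc : IsLocallyConstant (form K v) := by
    refine (IsLocallyConstant.iff_exists_open _).2 fun g => ?_
    refine ⟨(fun h => g⁻¹ * h) ⁻¹' (localCongruenceSubgroup 2 K v 2 : Set (GL (Fin 2) Kv)),
      (isOpen_localCongruenceSubgroup 2 K v 2).preimage (continuous_const_mul g⁻¹), ?_, fun h hh => ?_⟩
    · rw [Set.mem_preimage, SetLike.mem_coe, inv_mul_cancel]
      exact Subgroup.one_mem _
    · rw [Set.mem_preimage, SetLike.mem_coe] at hh
      have hf := form_mul_of_mem (K := K) (v := v) g hh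
      rwa [mul_inv_cancel_left] at hf
  exact hlc.continuous

/-- `supp ξ ⊆ U_1`. [folklore] -/
theorem support_form_subset : Function.support (form K v) ⊆ localCongruenceSubgroup 2 K v 1 :=
  fun _ hg => mem_of_form_ne_zero hg

/-- `tsupport ξ ⊆ U_1` (`U_1` is open, hence closed). [folklore] -/
theorem tsupport_form_subset :
    tsupport (form K v) ⊆ (localCongruenceSubgroup 2 K v 1 : Set (GL (Fin 2) Kv)) :=
  closure_minimal support_form_subset (Subgroup.isClosed_of_isOpen _ (isOpen_localCongruenceSubgroup 2 K v 1))

/-- **`ξ` has compact support** (inside the compact `U_1`). [folklore] -/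
theorem hasCompactSupport_form : HasCompactSupport (form K v) :=
  HasCompactSupport.intro' (isCompact_localCongruenceSubgroup 2 K v 1)
    (Subgroup.isClosed_of_isOpen _ (isOpen_localCongruenceSubgroup 2 K v 1)) fun _ hg => form_of_not_mem hg

/-! ### The finite cusp-form identity `Σ_r ξ(k₁ n(r) k₂) = 0` -/

/-- **The eigenvector obstruction, in coordinates.** In a field with `x² - x ≠ c` for all `x`: if
`γ α + δ β = 0`, `(α, β) ≠ 0` and `(γ, δ) ≠ 0` then `c β γ + α δ - β δ ≠ 0` (this is
`(P Y P⁻¹)₁₀ ≠ 0` for `Y = (0 c; 1 -1)`, `(α, β)ᵀ` the first column of `P⁻¹` and `(γ, δ)` the second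
row of `P`: otherwise `P⁻¹ e₀` would be an eigenvector of `Y`). [folklore] -/
theorem key_ne_zero {k : Type*} [Field k] {c : k} (hc : ∀ x : k, x * x - x ≠ c) {α β γ δ : k}
    (hrel : γ * α + δ * β = 0) (hαβ : ¬(α = 0 ∧ β = 0)) (hγδ : ¬(γ = 0 ∧ δ = 0)) :
    c * β * γ + α * δ - β * δ ≠ 0 := by
  intro h
  have hc0 : c ≠ 0 := fun h0 => hc 0 (by rw [h0]; ring)
  by_cases hβ : β = 0
  · have hα : α ≠ 0 := fun hα => hαβ ⟨hα, hβ⟩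
    have hγ : γ = 0 := by
      rw [hβ, mul_zero, add_zero] at hrel
      exact (mul_eq_zero.1 hrel).resolve_right hα
    have hδ : δ ≠ 0 := fun hδ => hγδ ⟨hγ, hδ⟩
    rw [hβ, hγ] at h
    have : α * δ = 0 := by linear_combination h
    exact (mul_ne_zero hα hδ) this
  · by_cases hδ : δ = 0
    · have hγ : γ ≠ 0 := fun hγ => hγδ ⟨hγ, hδ⟩
      have hα : α = 0 := by
        rw [hδ, zero_mul, add_zero] at hrel
        exact (mul_eq_zero.1 hrel).resolve_left hγ
      rw [hδ, hα] at h
      have : c * β * γ = 0 := by linear_combination h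
      exact mul_ne_zero (mul_ne_zero hc0 hβ) hγ this
    · have h2 : δ * (α * α - α * β - c * (β * β)) = 0 := by linear_combination α * h - c * β * hrel
      have h3 : α * α - α * β - c * (β * β) = 0 := (mul_eq_zero.1 h2).resolve_left hδ
      refine hc (α / β) ?_
      rw [eq_comm, eq_sub_iff_add_eq, div_mul_div_comm]
      field_simp
      linear_combination -h3

/-- `E = n(1) - 1 = e₀₁`. [folklore] -/
theorem coe_unipotent_one_sub_one :
    (((𝐧 (1 : Kv)) : GL (Fin 2) Kv) : Matrix (Fin 2) (Fin 2) Kv) - 1 = !![0, 1; 0, 0] := by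
  rw [coe_unipotentGL2]
  ext i j; fin_cases i <;> fin_cases j <;> simp

/-- `n(y) - 1 = y • e₀₁`. [folklore] -/
theorem coe_unipotent_sub_one (y : Kv) :
    (((𝐧 y) : GL (Fin 2) Kv) : Matrix (Fin 2) (Fin 2) Kv) - 1 = y • (!![0, 1; 0, 0] : Matrix (Fin 2) (Fin 2) Kv) := by
  rw [coe_unipotentGL2]
  ext i j; fin_cases i <;> fin_cases j <;> simp

/-- `(Q e₀₁ P)ᵢⱼ = Qᵢ₀ P₁ⱼ`. [folklore] -/
theorem mul_single_mul_apply (Q P : Matrix (Fin 2) (Fin 2) Kv) (i j : Fin 2) :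
    (Q * !![0, 1; 0, 0] * P : Matrix (Fin 2) (Fin 2) Kv) i j = Q i 0 * P 1 j := by
  simp [Matrix.mul_apply, Fin.sum_univ_two]

/-- **`λ̄ ≠ 0`**: for `k ∈ GL₂(𝒪_v)`, the reduction of `λ = ℓ(k⁻¹ e₀₁ k)` is non-zero. [folklore] -/
theorem red_lin_conj_single_ne_zero {k : GL (Fin 2) Kv} (hk : k ∈ localCongruenceSubgroup 2 K v 0) :
    red (lin K v (((k⁻¹ : GL (Fin 2) Kv) : Matrix (Fin 2) (Fin 2) Kv) * !![0, 1; 0, 0] *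
      (k : Matrix (Fin 2) (Fin 2) Kv))) ≠ 0 := by
  rw [mem_level_iff] at hk
  set P : Matrix (Fin 2) (Fin 2) Kv := (k : Matrix (Fin 2) (Fin 2) Kv) with hP
  set Q : Matrix (Fin 2) (Fin 2) Kv := ((k⁻¹ : GL (Fin 2) Kv) : Matrix (Fin 2) (Fin 2) Kv) with hQ
  have hPv : ∀ i j, Valued.v (P i j) ≤ 1 := hk.1
  have hQv : ∀ i j, Valued.v (Q i j) ≤ 1 := hk.2.1
  have hPQ : P * Q = 1 := by rw [hP, hQ, ← Units.val_mul, mul_inv_cancel, Units.val_one]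
  have hent : ∀ i j, Valued.v ((Q * !![0, 1; 0, 0] * P : Matrix (Fin 2) (Fin 2) Kv) i j) ≤ 1 := fun i j => by
    rw [mul_single_mul_apply, map_mul]; exact mul_le_one' (hQv i 0) (hPv 1 j)
  rw [red_lin hent, mul_single_mul_apply, mul_single_mul_apply, mul_single_mul_apply,
    red_mul (hQv 1 0) (hPv 1 0), red_mul (hQv 0 0) (hPv 1 1), red_mul (hQv 1 0) (hPv 1 1)]
  -- the relations from `P Q = 1`
  have h10 : P 1 0 * Q 0 0 + P 1 1 * Q 1 0 = 0 := by
    have := congrFun (congrFun hPQ 1) 0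
    simpa [Matrix.mul_apply, Fin.sum_univ_two] using this
  have h00 : P 0 0 * Q 0 0 + P 0 1 * Q 1 0 = 1 := by
    have := congrFun (congrFun hPQ 0) 0
    simpa [Matrix.mul_apply, Fin.sum_univ_two] using this
  have h11 : P 1 0 * Q 0 1 + P 1 1 * Q 1 1 = 1 := by
    have := congrFun (congrFun hPQ 1) 1
    simpa [Matrix.mul_apply, Fin.sum_univ_two] using this
  have hrel : red (P 1 0) * red (Q 0 0) + red (P 1 1) * red (Q 1 0) = 0 := by
    have := congrArg red h10
    rwa [red_add (by rw [map_mul]; exact mul_le_one' (hPv 1 0) (hQv 0 0))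
      (by rw [map_mul]; exact mul_le_one' (hPv 1 1) (hQv 1 0)),
      red_mul (hPv 1 0) (hQv 0 0), red_mul (hPv 1 1) (hQv 1 0), red_zero] at this
  have hαβ : ¬(red (Q 0 0) = 0 ∧ red (Q 1 0) = 0) := by
    rintro ⟨hα, hβ⟩
    have := congrArg red h00
    rw [red_add (by rw [map_mul]; exact mul_le_one' (hPv 0 0) (hQv 0 0))
      (by rw [map_mul]; exact mul_le_one' (hPv 0 1) (hQv 1 0)),
      red_mul (hPv 0 0) (hQv 0 0), red_mul (hPv 0 1) (hQv 1 0), red_one, hα, hβ] at this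
    simp at this
  have hγδ : ¬(red (P 1 0) = 0 ∧ red (P 1 1) = 0) := by
    rintro ⟨hγ, hδ⟩
    have := congrArg red h11
    rw [red_add (by rw [map_mul]; exact mul_le_one' (hPv 1 0) (hQv 0 1))
      (by rw [map_mul]; exact mul_le_one' (hPv 1 1) (hQv 1 1)),
      red_mul (hPv 1 0) (hQv 0 1), red_mul (hPv 1 1) (hQv 1 1), red_one, hγ, hδ] at this
    simp at this
  have key := key_ne_zero sq_sub_ne_cres hrel hαβ hγδ
  convert key using 1
  ring

variable (K v) in
/-- A section `k_v → 𝒪_v` of the residue map. [folklore] -/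
def sec (a : kv) : Kv := Classical.choose (exists_red_eq a)

/-- The section `sec` of the residue map takes integral values. [folklore] -/
theorem valued_sec_le (a : kv) : Valued.v (sec K v a) ≤ 1 := (Classical.choose_spec (exists_red_eq a)).1

/-- `sec` is a section of the residue map `red`. [folklore] -/
theorem red_sec (a : kv) : red (sec K v a) = a := (Classical.choose_spec (exists_red_eq a)).2

variable (K v) in
/-- The `q_v²` representatives `σ(a) + ϖ σ(b)` of `𝒪_v / 𝔭_v²`. [folklore] -/
def rep (p : kv × kv) : Kv := sec K v p.1 + unif K v * sec K v p.2

/-- The representatives `rep p` are integral. [folklore] -/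
theorem valued_rep_le (p : kv × kv) : Valued.v (rep K v p) ≤ 1 :=
  Valued.v.map_add_le (valued_sec_le _) (by rw [map_mul]; exact mul_le_one' valued_unif_le (valued_sec_le _))

/-- Difference of two representatives: `rep p - rep p₀ = (sec p.1 - sec p₀.1) + unif * (sec p.2 - sec p₀.2)`. [folklore] -/
theorem rep_sub_rep (p p₀ : kv × kv) :
    rep K v p - rep K v p₀ = (sec K v p.1 - sec K v p₀.1) + unif K v * (sec K v p.2 - sec K v p₀.2) := by
  simp only [rep]; ring

/-- `k₁ n(r) k₂ = (k₁ n(r₀) k₂) · (k₂⁻¹ n(r - r₀) k₂)`. [folklore] -/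
theorem mul_unipotent_mul_eq (k₁ k₂ : GL (Fin 2) Kv) (r r₀ : Kv) :
    k₁ * (𝐧 r) * k₂ = k₁ * (𝐧 r₀) * k₂ * (k₂⁻¹ * (𝐧 (r - r₀)) * k₂) := by
  have h : ((unipotentGL2 r : ↥(upperUnitriangular (Fin 2) Kv)) : GL (Fin 2) Kv) =
      (𝐧 r₀) * (𝐧 (r - r₀)) := by
    rw [← Subgroup.coe_mul, ← unipotentGL2_add, add_sub_cancel]
  rw [h]; group

/-- For `g₀ ∈ U_1` and `k₂ ∈ U_0`: `g₀ (k₂⁻¹ n(y) k₂) ∈ U_1 ↔ |y| ≤ |ϖ|`. [folklore] -/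
theorem mul_conj_unipotent_mem_level_one_iff {g₀ k₂ : GL (Fin 2) Kv}
    (hg₀ : g₀ ∈ localCongruenceSubgroup 2 K v 1) (hk₂ : k₂ ∈ localCongruenceSubgroup 2 K v 0) (y : Kv) :
    g₀ * (k₂⁻¹ * (𝐧 y) * k₂) ∈ localCongruenceSubgroup 2 K v 1 ↔ Valued.v y ≤ WithZero.exp (-1 : ℤ) := by
  rw [Subgroup.mul_mem_cancel_left _ hg₀]
  constructor
  · intro h
    have h' := conj_mem_level hk₂ h
    rw [show k₂ * (k₂⁻¹ * (𝐧 y) * k₂) * k₂⁻¹ = (𝐧 y) by group] at h'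
    simpa using (unipotent_mem_level_iff y 1).1 h'
  · intro h
    exact inv_conj_mem_level hk₂ ((unipotent_mem_level_iff y 1).2 (by simpa using h))

/-- `|σ(a) - σ(a₀) + ϖ t| ≤ |ϖ| ↔ a = a₀`. [folklore] -/
theorem valued_rep_sub_le_iff (p p₀ : kv × kv) :
    Valued.v (rep K v p - rep K v p₀) ≤ WithZero.exp (-1 : ℤ) ↔ p.1 = p₀.1 := by
  rw [rep_sub_rep]
  have ht : Valued.v (unif K v * (sec K v p.2 - sec K v p₀.2)) ≤ WithZero.exp (-1 : ℤ) := by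
    rw [map_mul, valued_unif]
    exact mul_le_of_le_one_right' (Valued.v.map_sub_le (valued_sec_le _) (valued_sec_le _))
  rw [valued_add_le_iff_of_le ht, ← valued_lt_one_iff,
    ← red_eq_zero_iff (Valued.v.map_sub_le (valued_sec_le _) (valued_sec_le _)),
    red_sub (valued_sec_le _) (valued_sec_le _), red_sec, red_sec, sub_eq_zero]

/-- `(k⁻¹ n(y) k) - 1 = y • (k⁻¹ e₀₁ k)`. [folklore] -/
theorem coe_conj_unipotent_sub_one (k : GL (Fin 2) Kv) (y : Kv) :
    ((k⁻¹ * (𝐧 y) * k : GL (Fin 2) Kv) : Matrix (Fin 2) (Fin 2) Kv) - 1 =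
      y • (((k⁻¹ : GL (Fin 2) Kv) : Matrix (Fin 2) (Fin 2) Kv) * !![0, 1; 0, 0] * (k : Matrix (Fin 2) (Fin 2) Kv)) := by
  have hkk : ((k⁻¹ : GL (Fin 2) Kv) : Matrix (Fin 2) (Fin 2) Kv) * (k : Matrix (Fin 2) (Fin 2) Kv) = 1 := by
    rw [← Units.val_mul, inv_mul_cancel, Units.val_one]
  have h : ((k⁻¹ * (𝐧 y) * k : GL (Fin 2) Kv) : Matrix (Fin 2) (Fin 2) Kv) - 1 =
      ((k⁻¹ : GL (Fin 2) Kv) : Matrix (Fin 2) (Fin 2) Kv) *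
        ((((𝐧 y) : GL (Fin 2) Kv) : Matrix (Fin 2) (Fin 2) Kv) - 1) * (k : Matrix (Fin 2) (Fin 2) Kv) := by
    rw [Units.val_mul, Units.val_mul, Matrix.mul_sub, Matrix.sub_mul, Matrix.mul_one, hkk]
  rw [h, coe_unipotent_sub_one, Matrix.mul_smul, Matrix.smul_mul]

/-- **The congruence condition along a coset.** For `g₀ ∈ U_1`, `k ∈ U_0` and an integer `t`, with
`u = k⁻¹ n(ϖ t) k`: `Cond (g₀ u) ↔ red (ℓ(g₀ - 1)/ϖ) + red t · red λ = 0`, `λ = ℓ(k⁻¹ e₀₁ k)`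
(`g₀ u - 1 = (g₀-1) + (u-1) + (g₀-1)(u-1)`, the last term in `𝔭²`, `ℓ(u-1) = ϖ t λ`). [folklore] -/
theorem cond_mul_conj_unipotent_iff {g₀ k : GL (Fin 2) Kv} (hg₀ : g₀ ∈ localCongruenceSubgroup 2 K v 1)
    (hk : k ∈ localCongruenceSubgroup 2 K v 0) {t : Kv} (ht : Valued.v t ≤ 1) :
    Cond K v (g₀ * (k⁻¹ * (𝐧 (unif K v * t)) * k)) ↔
      red (lin K v ((g₀ : Matrix (Fin 2) (Fin 2) Kv) - 1) * (unif K v)⁻¹) +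
        red t * red (lin K v (((k⁻¹ : GL (Fin 2) Kv) : Matrix (Fin 2) (Fin 2) Kv) * !![0, 1; 0, 0] *
          (k : Matrix (Fin 2) (Fin 2) Kv))) = 0 := by
  set u : GL (Fin 2) Kv := k⁻¹ * (𝐧 (unif K v * t)) * k with hu
  set lam : Kv := lin K v (((k⁻¹ : GL (Fin 2) Kv) : Matrix (Fin 2) (Fin 2) Kv) * !![0, 1; 0, 0] *
    (k : Matrix (Fin 2) (Fin 2) Kv)) with hlam
  set L₀ : Kv := lin K v ((g₀ : Matrix (Fin 2) (Fin 2) Kv) - 1) with hL₀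
  have hu1 : u ∈ localCongruenceSubgroup 2 K v 1 := by
    refine inv_conj_mem_level hk ((unipotent_mem_level_iff _ 1).2 ?_)
    rw [Nat.cast_one, map_mul, valued_unif]
    exact mul_le_of_le_one_right' ht
  rw [mem_level_iff] at hg₀ hk hu1
  -- the matrix identity
  have hmat : ((g₀ * u : GL (Fin 2) Kv) : Matrix (Fin 2) (Fin 2) Kv) - 1 =
      ((g₀ : Matrix (Fin 2) (Fin 2) Kv) - 1) + ((u : Matrix (Fin 2) (Fin 2) Kv) - 1) +
        ((g₀ : Matrix (Fin 2) (Fin 2) Kv) - 1) * ((u : Matrix (Fin 2) (Fin 2) Kv) - 1) := by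
    rw [Units.val_mul, Matrix.sub_mul, Matrix.mul_sub, Matrix.one_mul, Matrix.mul_one]; abel
  have hthird : Valued.v (lin K v (((g₀ : Matrix (Fin 2) (Fin 2) Kv) - 1) * ((u : Matrix (Fin 2) (Fin 2) Kv) - 1))) ≤
      WithZero.exp (-2 : ℤ) := by
    refine valued_lin_le fun i j => ?_
    have h := valued_mul_apply_le (m := Fin 2) hg₀.2.2 hu1.2.2 i j
    rwa [← WithZero.exp_add, Nat.cast_one, show (-1 : ℤ) + -1 = -2 by norm_num] at h
  have hlinu : lin K v ((u : Matrix (Fin 2) (Fin 2) Kv) - 1) = unif K v * t * lam := by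
    rw [hu, coe_conj_unipotent_sub_one, lin_smul]
  -- integrality of `lam` and of `s = L₀ / ϖ`
  have hlam1 : Valued.v lam ≤ 1 := valued_lin_le fun i j => by
    rw [mul_single_mul_apply, map_mul]; exact mul_le_one' (hk.2.1 i 0) (hk.1 1 j)
  have hL₀v : Valued.v L₀ ≤ WithZero.exp (-1 : ℤ) := by
    refine valued_lin_le fun i j => ?_
    simpa only [Nat.cast_one] using hg₀.2.2 i j
  have hs1 : Valued.v (L₀ * (unif K v)⁻¹) ≤ 1 := by
    rw [map_mul, map_inv₀, valued_unif]
    calc Valued.v L₀ * (WithZero.exp (-1 : ℤ))⁻¹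
        ≤ WithZero.exp (-1 : ℤ) * (WithZero.exp (-1 : ℤ))⁻¹ := mul_le_mul_left hL₀v _
      _ = 1 := mul_inv_cancel₀ WithZero.exp_ne_zero
  have hsum : L₀ + unif K v * t * lam = unif K v * (L₀ * (unif K v)⁻¹ + t * lam) := by
    field_simp [unif_ne_zero (K := K) (v := v)]
  unfold Cond
  rw [hmat, lin_add, lin_add, valued_add_le_iff_of_le hthird, ← hL₀, hlinu, hsum,
    show (-2 : ℤ) = -(1 + 1) by norm_num, valued_unif_mul_le_iff, ← valued_lt_one_iff,
    ← red_eq_zero_iff (Valued.v.map_add_le hs1 (by rw [map_mul]; exact mul_le_one' ht hlam1)),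
    red_add hs1 (by rw [map_mul]; exact mul_le_one' ht hlam1), red_mul ht hlam1]

/-- `Σ_b (if b = b₁ then q - 1 else -1) = 0` over the residue field (`q` terms). [folklore] -/
theorem sum_ite_eq_zero [Fintype kv] (b₁ : kv) :
    ∑ b : kv, (if b = b₁ then ((qv K v : ℂ) - 1) else -1) = 0 := by
  have h : ∀ b : kv, (if b = b₁ then ((qv K v : ℂ) - 1) else -1) = (if b = b₁ then (qv K v : ℂ) else 0) - 1 := by
    intro b; split_ifs <;> ring
  simp_rw [h]
  rw [Finset.sum_sub_distrib, Finset.sum_ite_eq', if_pos (Finset.mem_univ _), Finset.sum_const,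
    Finset.card_univ, qv, Nat.card_eq_fintype_card, nsmul_eq_mul, mul_one, sub_self]

/-- **The cusp-form identity of `GL₂(𝒪_v/𝔭_v²)`**: for `k₂ ∈ GL₂(𝒪_v)` (and any `k₁`),
`Σ_{(a,b)} ξ(k₁ n(σ(a) + ϖ σ(b)) k₂) = 0`. Either no `k₁ n(r) k₂` lies in `U_1` (all terms vanish), or
they do exactly for `r = r₀ + ϖ t`, `t` running over `σ(b) - σ(b₀)`; then
`ξ(k₁ n(r) k₂) = q - 1` for the unique `b` with `red s + (b - b₀) λ̄ = 0` (`λ̄ ≠ 0`,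
`red_lin_conj_single_ne_zero`) and `-1` for the other `q - 1` values of `b`.
[cite: BushnellHenniart2006, §11] -/
theorem sum_form_unipotent_eq_zero [Fintype kv] (k₁ : GL (Fin 2) Kv) {k₂ : GL (Fin 2) Kv}
    (hk₂ : k₂ ∈ localCongruenceSubgroup 2 K v 0) :
    ∑ p : kv × kv, form K v (k₁ * (𝐧 (rep K v p)) * k₂) = 0 := by
  by_cases hex : ∃ p₀ : kv × kv, k₁ * (𝐧 (rep K v p₀)) * k₂ ∈ localCongruenceSubgroup 2 K v 1
  swap
  · push Not at hex
    exact Finset.sum_eq_zero fun p _ => form_of_not_mem (hex p)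
  obtain ⟨p₀, hp₀⟩ := hex
  set g₀ : GL (Fin 2) Kv := k₁ * (𝐧 (rep K v p₀)) * k₂ with hg₀
  -- every term is `g₀ · (k₂⁻¹ n(r - r₀) k₂)`
  have hS : ∀ p : kv × kv, k₁ * (𝐧 (rep K v p)) * k₂ = g₀ * (k₂⁻¹ * (𝐧 (rep K v p - rep K v p₀)) * k₂) :=
    fun p => mul_unipotent_mul_eq k₁ k₂ _ _
  have hmem : ∀ p : kv × kv, k₁ * (𝐧 (rep K v p)) * k₂ ∈ localCongruenceSubgroup 2 K v 1 ↔ p.1 = p₀.1 := by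
    intro p
    rw [hS, mul_conj_unipotent_mem_level_one_iff hp₀ hk₂, valued_rep_sub_le_iff]
  -- reduce the sum to the fibre `a = a₀`
  rw [Fintype.sum_prod_type, Finset.sum_eq_single p₀.1]
  rotate_left
  · intro a _ ha
    exact Finset.sum_eq_zero fun b _ => form_of_not_mem fun h => ha ((hmem (a, b)).1 h)
  · intro h; exact absurd (Finset.mem_univ _) h
  -- on the fibre: `r - r₀ = ϖ t_b`
  set lam : Kv := lin K v (((k₂⁻¹ : GL (Fin 2) Kv) : Matrix (Fin 2) (Fin 2) Kv) * !![0, 1; 0, 0] *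
    (k₂ : Matrix (Fin 2) (Fin 2) Kv)) with hlam
  set s : Kv := lin K v ((g₀ : Matrix (Fin 2) (Fin 2) Kv) - 1) * (unif K v)⁻¹ with hs
  have hlam0 : red lam ≠ 0 := red_lin_conj_single_ne_zero hk₂
  set b₁ : kv := p₀.2 - red s * (red lam)⁻¹ with hb₁
  have hterm : ∀ b : kv, form K v (k₁ * (𝐧 (rep K v (p₀.1, b))) * k₂) =
      if b = b₁ then ((qv K v : ℂ) - 1) else -1 := by
    intro b
    have hmemb : k₁ * (𝐧 (rep K v (p₀.1, b))) * k₂ ∈ localCongruenceSubgroup 2 K v 1 := (hmem (p₀.1, b)).2 rfl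
    rw [form_of_mem hmemb]
    have hdiff : rep K v (p₀.1, b) - rep K v p₀ = unif K v * (sec K v b - sec K v p₀.2) := by
      rw [rep_sub_rep]; simp
    have ht : Valued.v (sec K v b - sec K v p₀.2) ≤ 1 := Valued.v.map_sub_le (valued_sec_le _) (valued_sec_le _)
    have hcond : Cond K v (k₁ * (𝐧 (rep K v (p₀.1, b))) * k₂) ↔ b = b₁ := by
      rw [hS, hdiff, cond_mul_conj_unipotent_iff hp₀ hk₂ ht, ← hs, ← hlam,
        red_sub (valued_sec_le _) (valued_sec_le _), red_sec, red_sec, hb₁]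
      constructor
      · intro h
        field_simp
        linear_combination h
      · intro h
        rw [h]
        field_simp
        ring
    simp only [hcond]
  simp_rw [hterm]
  exact sum_ite_eq_zero b₁

/-! ### `ξ` is a supercusp form: `∫ ξ(a n(x) b) dx = 0` -/

/-- `x ↦ a n(x) b` is a closed embedding of `K_v` into `GL₂(K_v)` (`N₂` is closed). [folklore] -/
theorem isClosedEmbedding_mul_unipotent_mul (a b : GL (Fin 2) Kv) :
    Topology.IsClosedEmbedding fun x : Kv => a * (𝐧 x) * b := by
  have hn : Topology.IsClosedEmbedding fun x : Kv => (((unipotentGL2 x : ↥(upperUnitriangular (Fin 2) Kv)) :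
      GL (Fin 2) Kv)) :=
    (isClosed_upperUnitriangular (n := 2) (R := Kv)).isClosedEmbedding_subtypeVal.comp
      (unipotentHomeomorphGL2 (R := Kv)).isClosedEmbedding
  exact (Homeomorph.mulRight b).isClosedEmbedding.comp ((Homeomorph.mulLeft a).isClosedEmbedding.comp hn)

/-- `x ↦ ξ(a n(x) b)` is continuous. [folklore] -/
theorem continuous_form_comp (a b : GL (Fin 2) Kv) : Continuous fun x : Kv => form K v (a * (𝐧 x) * b) :=
  continuous_form.comp (isClosedEmbedding_mul_unipotent_mul a b).continuous

/-- `x ↦ ξ(a n(x) b)` has compact support. [folklore] -/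
theorem hasCompactSupport_form_comp (a b : GL (Fin 2) Kv) :
    HasCompactSupport fun x : Kv => form K v (a * (𝐧 x) * b) :=
  hasCompactSupport_form.comp_isClosedEmbedding (isClosedEmbedding_mul_unipotent_mul a b)

/-- **Pointwise vanishing of the averaged integrand**: for `k₁ ∈ GL₂(𝒪_v)` and every `g`,
`Σ_r ξ(k₁ n(r) g) = 0` — by `sum_form_unipotent_eq_zero` if `g ∈ GL₂(𝒪_v)`, and termwise
otherwise (`ξ(k₁ n(r) g) ≠ 0` forces `g ∈ n(r)⁻¹ k₁⁻¹ U_1 ⊆ GL₂(𝒪_v)`). [folklore] -/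
theorem sum_form_unipotent_mul_eq_zero [Fintype kv] {k₁ : GL (Fin 2) Kv}
    (hk₁ : k₁ ∈ localCongruenceSubgroup 2 K v 0) (g : GL (Fin 2) Kv) :
    ∑ p : kv × kv, form K v (k₁ * (𝐧 (rep K v p)) * g) = 0 := by
  by_cases hg : g ∈ localCongruenceSubgroup 2 K v 0
  · exact sum_form_unipotent_eq_zero k₁ hg
  · refine Finset.sum_eq_zero fun p _ => form_of_not_mem fun h => hg ?_
    have hn : ((unipotentGL2 (rep K v p) : ↥(upperUnitriangular (Fin 2) Kv)) : GL (Fin 2) Kv) ∈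
        localCongruenceSubgroup 2 K v 0 := (unipotent_mem_level_zero_iff _).2 (valued_rep_le p)
    have h0 : k₁ * (𝐧 (rep K v p)) * g ∈ localCongruenceSubgroup 2 K v 0 := level_le zero_le_one h
    have := Subgroup.mul_mem _ (Subgroup.inv_mem _ (Subgroup.mul_mem _ hk₁ hn)) h0
    rwa [inv_mul_cancel_left] at this

section Integral

/-- `x ↦ ξ(a n(x) b)` is integrable for every measure finite on compacts. [folklore] -/
theorem integrable_form_comp [MeasurableSpace Kv] [BorelSpace Kv] (dx : Measure Kv)
    [IsFiniteMeasureOnCompacts dx] (a b : GL (Fin 2) Kv) :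
    Integrable (fun x : Kv => form K v (a * (𝐧 x) * b)) dx := by
  haveI : SecondCountableTopology Kv := secondCountableTopology_adicCompletion K v
  exact (continuous_form_comp a b).integrable_of_hasCompactSupport (hasCompactSupport_form_comp a b)

/-- **`∫ ξ(k₁ n(x) b) dx = 0` for `k₁ ∈ GL₂(𝒪_v)`**: `q² ∫ ξ(k₁ n(x) b) dx = Σ_r ∫ ξ(k₁ n(r + x) b) dx
= ∫ Σ_r ξ(k₁ n(r) (n(x) b)) dx = 0`. [folklore] -/
theorem integral_form_level_zero_eq_zero [MeasurableSpace Kv] [BorelSpace Kv] (dx : Measure Kv)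
    [dx.IsAddHaarMeasure] {k₁ : GL (Fin 2) Kv} (hk₁ : k₁ ∈ localCongruenceSubgroup 2 K v 0)
    (b : GL (Fin 2) Kv) : ∫ x, form K v (k₁ * (𝐧 x) * b) ∂dx = 0 := by
  haveI : Fintype kv := Fintype.ofFinite _
  set I : ℂ := ∫ x, form K v (k₁ * (𝐧 x) * b) ∂dx with hI
  -- shifted integrals all equal `I`
  have hshift : ∀ p : kv × kv,
      ∫ x, form K v (k₁ * (𝐧 (rep K v p)) * ((𝐧 x) * b)) ∂dx = I := by
    intro p
    have h := integral_add_left_eq_self (μ := dx) (fun x => form K v (k₁ * (𝐧 x) * b)) (rep K v p)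
    rw [hI, ← h]
    refine integral_congr_ae (Filter.Eventually.of_forall fun x => ?_)
    simp only [unipotentGL2_add, Subgroup.coe_mul, mul_assoc]
  have hint : ∀ p : kv × kv, Integrable (fun x => form K v (k₁ * (𝐧 (rep K v p)) * ((𝐧 x) * b))) dx := by
    intro p
    have h := integrable_form_comp dx (k₁ * (𝐧 (rep K v p))) b
    simpa only [mul_assoc] using h
  have hsum : (Fintype.card (kv × kv) : ℂ) * I =
      ∫ x, ∑ p : kv × kv, form K v (k₁ * (𝐧 (rep K v p)) * ((𝐧 x) * b)) ∂dx := by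
    rw [integral_finsetSum _ fun p _ => hint p]
    simp only [hshift, Finset.sum_const, Finset.card_univ, nsmul_eq_mul]
  have hzero : ∫ x, ∑ p : kv × kv, form K v (k₁ * (𝐧 (rep K v p)) * ((𝐧 x) * b)) ∂dx = 0 := by
    simp only [sum_form_unipotent_mul_eq_zero hk₁, integral_zero]
  rw [hzero] at hsum
  have hcard : (Fintype.card (kv × kv) : ℂ) ≠ 0 := by exact_mod_cast Fintype.card_ne_zero
  exact (mul_eq_zero.1 hsum).resolve_left hcard

/-- `diagonalGL d = d(d₀, d₁)` for `GL₂`. [folklore] -/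
theorem diagonalGL_eq_diagGL2 (d : Fin 2 → Kvˣ) : diagonalGL (Fin 2) Kv d = diagGL2 (d 0) (d 1) := by
  refine Units.ext ?_
  rw [coe_diagonalGL, coe_diagGL2]
  ext i j; fin_cases i <;> fin_cases j <;> simp

/-- **`ξ` is a supercusp form**: `∫_{K_v} ξ(a n(x) b) dx = 0` for all `a, b ∈ GL₂(K_v)` and every
additive Haar measure `dx` (Iwasawa `a = k⁻¹ d⁻¹ n(-t)`; `d⁻¹ n(y) d = n(d₀⁻¹ y d₁)`; translation and
dilation change the integral by a positive constant; then `integral_form_level_zero_eq_zero`).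
Gelbart (1975), (10.16): "`∫_{N_v} f_v(g n h) dn = 0`". [cite: Gelbart1975, §10 (10.16)] -/
theorem integral_form_unipotentGL2_eq_zero [MeasurableSpace Kv] [BorelSpace Kv] (dx : Measure Kv)
    [dx.IsAddHaarMeasure] (a b : GL (Fin 2) Kv) :
    ∫ x, form K v (a * (𝐧 x) * b) ∂dx = 0 := by
  haveI : SecondCountableTopology Kv := secondCountableTopology_adicCompletion K v
  -- Iwasawa for `a⁻¹`
  obtain ⟨u, hu, d, k, hk, hak⟩ := exists_unipotent_mul_diagonal_mul_glInt a⁻¹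
  rw [glInt_eq_level_zero] at hk
  rw [diagonalGL_eq_diagGL2] at hak
  set t : Kv := ((u : GL (Fin 2) Kv) : Matrix (Fin 2) (Fin 2) Kv) 0 1 with ht
  have hut : u = (𝐧 t) := by
    have h := unipotentGL2_entry (⟨u, hu⟩ : ↥(upperUnitriangular (Fin 2) Kv))
    exact (congrArg Subtype.val h).symm
  have ha : a = k⁻¹ * (diagGL2 (d 0) (d 1))⁻¹ * (𝐧 (-t)) := by
    rw [← GL2.coe_unipotentGL2_inv, ← hut, ← _root_.mul_inv_rev, ← _root_.mul_inv_rev, ← mul_assoc, ← hak,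
      inv_inv]
  -- `a n(x) b = k⁻¹ n(e x) (d⁻¹ n(-t) b)`, `e = d₀⁻¹ d₁` (`n(-t)` commutes past `n(x)`)
  set e : Kvˣ := (d 0)⁻¹ * d 1 with he
  have hconj : ∀ y : Kv, (diagGL2 (d 0) (d 1))⁻¹ * (𝐧 y) = (𝐧 ((e : Kv) * y)) * (diagGL2 (d 0) (d 1))⁻¹ := by
    intro y
    rw [he, Units.val_mul, mul_right_comm, ← diagGL2_inv_mul_unipotentGL2_mul_diagGL2, mul_inv_cancel_right]
  have hcomm : ∀ x : Kv, (𝐧 (-t)) * (𝐧 x) = (𝐧 x) * (𝐧 (-t)) := by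
    intro x
    rw [← Subgroup.coe_mul, ← Subgroup.coe_mul, ← unipotentGL2_add, ← unipotentGL2_add, add_comm]
  have hrew : ∀ x : Kv, a * (𝐧 x) * b =
      k⁻¹ * (𝐧 ((e : Kv) * x)) * ((diagGL2 (d 0) (d 1))⁻¹ * ((𝐧 (-t)) * b)) := by
    intro x
    calc a * (𝐧 x) * b
        = k⁻¹ * (diagGL2 (d 0) (d 1))⁻¹ * ((𝐧 (-t)) * (𝐧 x)) * b := by rw [ha]; simp only [mul_assoc]
      _ = k⁻¹ * ((diagGL2 (d 0) (d 1))⁻¹ * (𝐧 x)) * ((𝐧 (-t)) * b) := by rw [hcomm]; simp only [mul_assoc]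
      _ = k⁻¹ * ((𝐧 ((e : Kv) * x)) * (diagGL2 (d 0) (d 1))⁻¹) * ((𝐧 (-t)) * b) := by rw [hconj]
      _ = k⁻¹ * (𝐧 ((e : Kv) * x)) * ((diagGL2 (d 0) (d 1))⁻¹ * ((𝐧 (-t)) * b)) := by simp only [mul_assoc]
  -- dilation by the unit `e`
  set φ : Kv ≃+ Kv := (AddAut.mulLeft e : Kv ≃+ Kv) with hφ
  have hφc : Continuous φ := continuous_const.mul continuous_id
  have hφs : Continuous φ.symm := continuous_const.mul continuous_id
  obtain ⟨κ, -, hκ⟩ := exists_map_addEquiv_eq_smul dx φ hφc hφs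
  have key : ∀ x : Kv, form K v (a * (𝐧 x) * b) =
      (fun y => form K v (k⁻¹ * (𝐧 y) * ((diagGL2 (d 0) (d 1))⁻¹ * ((𝐧 (-t)) * b)))) (φ x) := by
    intro x
    rw [hrew]
    rfl
  simp_rw [key]
  have h2 := integral_comp_addEquiv_eq_smul dx φ hφc hφs hκ
    (fun y => form K v (k⁻¹ * (𝐧 y) * ((diagGL2 (d 0) (d 1))⁻¹ * ((𝐧 (-t)) * b))))
  beta_reduce at h2
  rw [h2, integral_form_level_zero_eq_zero dx (Subgroup.inv_mem _ hk), smul_zero]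

end Integral

/-- **The `𝔫₁`-form of the supercusp property** (the hypothesis of
`SupercuspidalPlaceNonvanishingCusp.integral_localTestFunction_comp_glUnipotent_eq_zero`):
`∫_{𝔫₁(K_v)} ξ(a (1 + Y) b) dY = 0` for all `a, b`, any Borel structure and every additive Haar
measure on `𝔫₁(K_v)` (transport along `x ↦ x e₀₁`, `1 + x e₀₁ = n(x)`, as in
`GL2.supercusp_unipotentGL2_of_blockNilpotent`). [cite: Gelbart1975, §10 (10.16)] -/
theorem integral_form_unipotentOfBlock_eq_zero [MeasurableSpace (blockNilpotent 2 1 Kv)]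
    [BorelSpace (blockNilpotent 2 1 Kv)] (α : Measure (blockNilpotent 2 1 Kv)) [α.IsAddHaarMeasure]
    (a b : GL (Fin 2) Kv) :
    ∫ Y, form K v (a * unipotentOfBlock 2 1 Kv (Multiplicative.ofAdd Y) * b) ∂α = 0 := by
  letI : MeasurableSpace Kv := borel _
  haveI : BorelSpace Kv := ⟨rfl⟩
  set ι : Kv ≃+ blockNilpotent 2 1 Kv := (AddEquiv.neg Kv).trans negBlockEquivGL2 with hι
  have hιa : ∀ x, ι x = negBlockEquivGL2 (-x) := fun _ => rfl
  have hιc : Continuous ι := by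
    rw [show (ι : Kv → blockNilpotent 2 1 Kv) = fun x => negBlockEquivGL2 (-x) from funext hιa]
    exact continuous_negBlockEquivGL2.comp continuous_neg
  have hιs : Continuous ι.symm := by
    rw [show (ι.symm : blockNilpotent 2 1 Kv → Kv) = fun Y => -(negBlockEquivGL2.symm Y) from
      funext fun _ => rfl]
    exact continuous_negBlockEquivGL2_symm.neg
  set β : Measure Kv := Measure.map ι.symm α with hβ
  haveI : β.IsAddHaarMeasure := ι.symm.isAddHaarMeasure_map α hιs (by simpa using hιc)
  let em : Kv ≃ᵐ blockNilpotent 2 1 Kv :=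
    { ι.toEquiv with measurable_toFun := hιc.measurable, measurable_invFun := hιs.measurable }
  have hem : ⇑em = ⇑ι := rfl
  have hαβ : α = Measure.map em β := by
    rw [hem, hβ, Measure.map_map hιc.measurable hιs.measurable]
    simp
  rw [hαβ, integral_map_equiv]
  simp only [hem, hιa, GL2.unipotentOfBlock_negBlockEquivGL2_neg]
  exact integral_form_unipotentGL2_eq_zero β a b

end GL2LocalSupercuspForm

end Literature.NumberTheory.Automorphic
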